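import Mathlib.Analysis.Convex.Basic
import Mathlib.MeasureTheory.Measure.Lebesgue.EqHaar
import Literature.Analysis.FunctionSpaces.TorusGridCells
import Literature.Analysis.FunctionSpaces.FlatTorusProofs
import HarnessLib

/-!
# Geometry of the grid cells of mesh `N⁻¹`: index, diameter, convexity, volume, tiling

Analysis/FunctionSpaces support file (notion `flat_torus_T3`), companion of `TorusGridCells` and
`TorusCellAverages`: the elementary geometry of the half-open cells
`Q_N(m) = {y | N • y - m ∈ [0,1)^d} = ∏ᵢ [mᵢ/N, (mᵢ+1)/N)`, `m ∈ ℤ^d`, of `ℝ^d`: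

* `gridIndex N y = (⌊N yᵢ⌋)ᵢ` and `mem_gridCell_iff_gridIndex_eq` (`y ∈ Q_N(m) ↔ ⌊N y⌋ = m`);
* `norm_sub_le_of_mem_gridCell` (two points of a cell are at distance `≤ √d / N`),
  `convex_gridCell`, `volume_gridCell` (`= N^{-d}`), `volume_unitCube` (`= 1`);
* the cells indexed by `j : d → Fin N` tile the fundamental cube `[0,1)^d`
  (`gridCell_subset_unitCube`, `pairwise_disjoint_gridCell`, `iUnion_gridCell_eq_unitCube`),
  whence `∫_{[0,1)^d} = Σ_j ∫_{Q_N(j)}` for lower Lebesgue and for Bochner integrals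
  (`lintegral_unitCube_eq_sum_gridCell`, `integral_unitCube_eq_sum_gridCell`).

These are the cells `Q ∈ 𝒬(N)` of Bruè–De Lellis 2023, §4 (up to null boundaries).

## References

* E. Bruè, C. De Lellis, Comm. Math. Phys. 400 (2023), §4 (notation `𝒬(λ)`).
-/

noncomputable section

open Set Function MeasureTheory MeasureTheory.Measure Module
open scoped ENNReal

namespace Literature.Analysis.FunctionSpaces

namespace Torus

variable {d : Type*} [Fintype d] [DecidableEq d]

/-! ## The index of the cell containing a point -/

/-- The index `(⌊N yᵢ⌋)ᵢ ∈ ℤ^d` of the grid cell of mesh `N⁻¹` containing `y ∈ ℝ^d`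
(Bruè–De Lellis 2023, §4: the squares of `𝒬(N)` with vertices in `N⁻¹ℤ²`). [folklore] -/
def gridIndex (N : ℕ) (y : EuclideanSpace ℝ d) : d → ℤ := fun i => ⌊(N : ℝ) * y i⌋

omit [Fintype d] [DecidableEq d] in
/-- Coordinates of the cell index. [folklore] -/
@[simp]
theorem gridIndex_apply (N : ℕ) (y : EuclideanSpace ℝ d) (i : d) :
    gridIndex N y i = ⌊(N : ℝ) * y i⌋ :=
  rfl

/-- **A point lies in the cell of index `m` iff its index is `m`.** [folklore] -/
theorem mem_gridCell_iff_gridIndex_eq {N : ℕ} (hN : 0 < N) {m : d → ℤ} {y : EuclideanSpace ℝ d} :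
    (N : ℝ) • y - latticeVec m ∈ unitCube d ↔ gridIndex N y = m := by
  have hN' : (0 : ℝ) < N := by exact_mod_cast hN
  rw [mem_gridCell_iff hN, funext_iff]
  refine forall_congr' fun i => ?_
  rw [gridIndex_apply, Int.floor_eq_iff, div_le_iff₀ hN', lt_div_iff₀ hN']
  constructor <;> rintro ⟨h1, h2⟩ <;> constructor <;> linarith

/-- Every point lies in the cell of its own index. [folklore] -/
theorem mem_gridCell_gridIndex {N : ℕ} (hN : 0 < N) (y : EuclideanSpace ℝ d) :
    (N : ℝ) • y - latticeVec (gridIndex N y) ∈ unitCube d :=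
  (mem_gridCell_iff_gridIndex_eq hN).2 rfl

/-! ## Diameter and convexity -/

/-- **Two points of a grid cell are at distance at most `√d / N`.** [folklore] -/
theorem norm_sub_le_of_mem_gridCell {N : ℕ} (hN : 0 < N) {m : d → ℤ} {y z : EuclideanSpace ℝ d}
    (hy : (N : ℝ) • y - latticeVec m ∈ unitCube d) (hz : (N : ℝ) • z - latticeVec m ∈ unitCube d) :
    ‖y - z‖ ≤ Real.sqrt (Fintype.card d) / N := by
  have hN' : (0 : ℝ) < N := by exact_mod_cast hN
  have hy' := (mem_gridCell_iff hN).1 hy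
  have hz' := (mem_gridCell_iff hN).1 hz
  have hcoord : ∀ i, ‖(y - z) i‖ ^ 2 ≤ ((N : ℝ)⁻¹) ^ 2 := by
    intro i
    have h1 := hy' i
    have h2 := hz' i
    have e : ((m i : ℝ) + 1) / N = (m i : ℝ) / N + (N : ℝ)⁻¹ := by
      rw [add_div, one_div]
    have hab : |y i - z i| ≤ (N : ℝ)⁻¹ := by
      rw [abs_le]
      constructor <;> linarith [h1.1, h1.2, h2.1, h2.2]
    calc ‖(y - z) i‖ ^ 2 = |y i - z i| ^ 2 := by simp [Real.norm_eq_abs]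
      _ ≤ ((N : ℝ)⁻¹) ^ 2 := pow_le_pow_left₀ (abs_nonneg _) hab 2
  rw [EuclideanSpace.norm_eq]
  calc Real.sqrt (∑ i, ‖(y - z) i‖ ^ 2)
      ≤ Real.sqrt (∑ _i : d, ((N : ℝ)⁻¹) ^ 2) :=
        Real.sqrt_le_sqrt (Finset.sum_le_sum fun i _ => hcoord i)
    _ = Real.sqrt (Fintype.card d * ((N : ℝ)⁻¹) ^ 2) := by
        simp [Finset.sum_const, Finset.card_univ]
    _ = Real.sqrt (Fintype.card d) / N := by
        rw [Real.sqrt_mul (Nat.cast_nonneg _), Real.sqrt_sq (by positivity), div_eq_mul_inv]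

/-- **Grid cells are convex** (preimages of the cube, a product of intervals, under an affine
map). [folklore] -/
theorem convex_gridCell {N : ℕ} (hN : 0 < N) (m : d → ℤ) :
    Convex ℝ {y : EuclideanSpace ℝ d | (N : ℝ) • y - latticeVec m ∈ unitCube d} := by
  intro y hy z hz a b ha hb hab
  rw [mem_setOf_eq, mem_gridCell_iff hN] at hy hz ⊢
  intro i
  have h := convex_Ico ((m i : ℝ) / N) (((m i : ℝ) + 1) / N) ⟨(hy i).1, (hy i).2⟩
    ⟨(hz i).1, (hz i).2⟩ ha hb hab
  simpa [PiLp.add_apply, PiLp.smul_apply, smul_eq_mul] using h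

/-! ## Volumes -/

omit [DecidableEq d] in
/-- The unit cube `[0,1)^d` has Lebesgue measure `1` (it carries the Haar probability of the
torus through the measure-preserving section `repr`, `measurePreserving_repr`). [folklore] -/
theorem volume_unitCube : volume (unitCube d) = 1 := by
  have h2 : (volume.restrict (unitCube d)) univ = (volume : Measure (UnitAddTorus d)) univ := by
    rw [← (measurePreserving_repr (d := d)).map_eq, Measure.map_apply measurable_repr
      MeasurableSet.univ, preimage_univ]
  rw [Measure.restrict_apply MeasurableSet.univ, univ_inter, measure_univ] at h2
  exact h2

/-- **Volume of a grid cell**: `volume (Q_N(m)) = N^{-d}`. [folklore] -/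
theorem volume_gridCell {N : ℕ} (hN : 0 < N) (m : d → ℤ) :
    volume {y : EuclideanSpace ℝ d | (N : ℝ) • y - latticeVec m ∈ unitCube d} =
      ((N : ℝ≥0∞)⁻¹) ^ Fintype.card d := by
  have hN' : (N : ℝ) ≠ 0 := by exact_mod_cast hN.ne'
  have hset : {y : EuclideanSpace ℝ d | (N : ℝ) • y - latticeVec m ∈ unitCube d} =
      (fun y : EuclideanSpace ℝ d => (N : ℝ) • y) ⁻¹'
        ((fun w => w - latticeVec m) ⁻¹' unitCube d) := by
    ext y; simp
  rw [hset, addHaar_preimage_smul _ hN', finrank_euclideanSpace,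
    show (fun w : EuclideanSpace ℝ d => w - latticeVec m) = fun w => w + (-latticeVec m) from
      funext fun w => sub_eq_add_neg w _,
    measure_preimage_add_right, volume_unitCube, mul_one]
  rw [abs_of_pos (inv_pos.2 (pow_pos (by exact_mod_cast hN) _)), ← inv_pow,
    ENNReal.ofReal_pow (inv_nonneg.2 (Nat.cast_nonneg _)), ENNReal.ofReal_inv_of_pos
      (by exact_mod_cast hN), ENNReal.ofReal_natCast]

/-! ## The cells of the fundamental cube tile it -/

/-- The index vector in `ℤ^d` of a multi-index `j : d → Fin N`. [folklore] -/
def finIndex {N : ℕ} (j : d → Fin N) : d → ℤ := fun i => ((j i : ℕ) : ℤ)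

omit [Fintype d] [DecidableEq d] in
/-- Coordinates of `finIndex`. [folklore] -/
@[simp]
theorem finIndex_apply {N : ℕ} (j : d → Fin N) (i : d) : finIndex j i = ((j i : ℕ) : ℤ) := rfl

omit [Fintype d] [DecidableEq d] in
/-- `finIndex` is injective. [folklore] -/
theorem finIndex_injective {N : ℕ} : Injective (finIndex (d := d) (N := N)) := by
  intro j j' h
  funext i
  have := congrFun h i
  simp only [finIndex_apply, Nat.cast_inj] at this
  exact Fin.ext this

/-- Cells with index in `{0,…,N-1}^d` lie in the fundamental cube. [folklore] -/
theorem gridCell_subset_unitCube {N : ℕ} (hN : 0 < N) (j : d → Fin N) :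
    {y : EuclideanSpace ℝ d | (N : ℝ) • y - latticeVec (finIndex j) ∈ unitCube d} ⊆ unitCube d := by
  intro y hy i
  have hN' : (0 : ℝ) < N := by exact_mod_cast hN
  have h := (mem_gridCell_iff hN).1 hy i
  simp only [finIndex_apply, Int.cast_natCast] at h
  have hj0 : (0 : ℝ) ≤ ((j i : ℕ) : ℝ) := Nat.cast_nonneg _
  have hj1 : ((j i : ℕ) : ℝ) + 1 ≤ N := by exact_mod_cast (j i).isLt
  constructor
  · exact le_trans (div_nonneg hj0 hN'.le) h.1
  · exact lt_of_lt_of_le h.2 ((div_le_one hN').2 hj1)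

/-- Distinct multi-indices give disjoint cells. [folklore] -/
theorem pairwise_disjoint_gridCell {N : ℕ} (hN : 0 < N) :
    Pairwise (Disjoint on fun j : d → Fin N =>
      {y : EuclideanSpace ℝ d | (N : ℝ) • y - latticeVec (finIndex j) ∈ unitCube d}) := by
  intro j j' hjj'
  refine disjoint_left.2 fun y hy hy' => hjj' (finIndex_injective ?_)
  rw [mem_setOf_eq, mem_gridCell_iff_gridIndex_eq hN] at hy hy'
  rw [← hy, ← hy']

/-- **The cells tile the fundamental cube**: `[0,1)^d = ⋃_{j ∈ {0,…,N-1}^d} Q_N(j)`. [folklore] -/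
theorem iUnion_gridCell_eq_unitCube {N : ℕ} (hN : 0 < N) :
    (⋃ j : d → Fin N, {y : EuclideanSpace ℝ d | (N : ℝ) • y - latticeVec (finIndex j) ∈ unitCube d}) =
      unitCube d := by
  refine Subset.antisymm (iUnion_subset fun j => gridCell_subset_unitCube hN j) fun y hy => ?_
  have hN' : (0 : ℝ) < N := by exact_mod_cast hN
  -- the index of `y` has coordinates in `{0, …, N-1}`
  have h0 : ∀ i, 0 ≤ gridIndex N y i := fun i => by
    rw [gridIndex_apply]
    exact Int.floor_nonneg.2 (mul_nonneg hN'.le (hy i).1)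
  have h1 : ∀ i, (gridIndex N y i).toNat < N := fun i => by
    have hlt : gridIndex N y i < N := by
      rw [gridIndex_apply, Int.floor_lt]
      have := (hy i).2
      push_cast
      nlinarith
    omega
  refine mem_iUnion.2 ⟨fun i => ⟨(gridIndex N y i).toNat, h1 i⟩, ?_⟩
  rw [mem_setOf_eq, mem_gridCell_iff_gridIndex_eq hN]
  funext i
  simp only [finIndex_apply, Int.toNat_of_nonneg (h0 i)]

/-- **Cellwise decomposition of lower Lebesgue integrals over the fundamental cube.**
[folklore] -/
theorem lintegral_unitCube_eq_sum_gridCell {N : ℕ} (hN : 0 < N) (f : EuclideanSpace ℝ d → ℝ≥0∞) :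
    ∫⁻ y in unitCube d, f y =
      ∑ j : d → Fin N, ∫⁻ y in {y | (N : ℝ) • y - latticeVec (finIndex j) ∈ unitCube d}, f y := by
  conv_lhs => rw [← iUnion_gridCell_eq_unitCube hN]
  rw [lintegral_iUnion (fun j => measurableSet_gridCell N _) (pairwise_disjoint_gridCell hN),
    tsum_fintype]

/-- **Cellwise decomposition of Bochner integrals over the fundamental cube.** [folklore] -/
theorem integral_unitCube_eq_sum_gridCell {N : ℕ} (hN : 0 < N) {F : Type*} [NormedAddCommGroup F]
    [NormedSpace ℝ F] {f : EuclideanSpace ℝ d → F} (hf : IntegrableOn f (unitCube d) volume) :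
    ∫ y in unitCube d, f y =
      ∑ j : d → Fin N, ∫ y in {y | (N : ℝ) • y - latticeVec (finIndex j) ∈ unitCube d}, f y := by
  conv_lhs => rw [← iUnion_gridCell_eq_unitCube hN]
  exact integral_iUnion_fintype (fun j => measurableSet_gridCell N _) (pairwise_disjoint_gridCell hN)
    fun j => hf.mono_set (gridCell_subset_unitCube hN j)

end Torus

end Literature.Analysis.FunctionSpaces

end
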